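import Literature.Computability.QuantumComplexity.PauliLocal
import Literature.Combinatorics.SimpleGraph.PathSpectrum
import Mathlib.Combinatorics.SimpleGraph.AdjMatrix
import Mathlib.Analysis.Normed.Algebra.MatrixExponential
import HarnessLib

/-!
# The XY network Hamiltonian restricted to one excitation is the adjacency matrix

Topic `Literature/Computability/QuantumComplexity` — Christandl, Datta, Ekert, Landahl, *Perfect
state transfer in quantum spin networks*, Phys. Rev. Lett. 92, 187902 (2004), p. 2, formalised on
the tree's Pauli-string vocabulary (`PauliExpansion.lean`: `Pauli`, `pauliString`) and Mathlib's
`SimpleGraph.adjMatrix`; the open-chain / open-grid corollaries use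
`Literature/Combinatorics/SimpleGraph/PathSpectrum.lean` (Brouwer–Haemers §1.4.4, §1.4.6).

Filed for the pub-qadeq lane (HONEST FRAMING: instance-level adjudication of specific advantage
claims; no claim about BQP vs BPP or the summit): this is the bridge that makes the graph-spectral
closed forms of `PathSpectrum.lean` statements about the lane's lattice HAMILTONIANS in their
one-excitation sector — CLAIMS E-67 / item S-20 (Google 2026 magnon spectroscopy; SI benchmark
(S45) `H = Σ_⟨ij⟩ (g/2)(X_iX_j + Y_iY_j)` on open `L_x × L_y` grids = `g · xyHam (P_{L_x} □ P_{L_y})`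
below), and the number-conserving hopping layers of E-38 / S-12 and E-23 / S-5. Nothing here is
about the interacting (many-excitation) dynamics those rows adjudicate; it is the convention pin
"one-magnon block = g × adjacency matrix" with its eigenstates, as a theorem.

## What the source says

"We define the XY Hamiltonian H_G = ½ Σ_{(i,j)∈E(G)} [σ^x_i σ^x_j + σ^y_i σ^y_j] … The Hilbert space
𝓗_G associated with a network of N qubits is of dimension 2^N. However, the state transfer
dynamics is completely determined by the evolution in the N-dimensional subspace 𝒮_G spanned by
the basis vectors |n⟩, n = 1, …, N, corresponding to spin configurations in which all spins are
'down' apart from just one spin at the vertex n which is 'up'. … The operator of the total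
z-component of the spin … commutes with H_G … The dynamics are effectively confined to the subspace
𝒮_G. The Hamiltonian H_G, when restricted to this subspace, is represented by an N × N matrix that
is identical to the adjacency matrix A(G), Eq. (1), of the underlying graph G. Due to this, one may
express the time evolution of the network in the 𝒮_G subspace as a continuous-time quantum walk on
G" and, for the linear chain, "The eigenstates are given by |k̃⟩ = √(2/(N+1)) Σ_{n=1}^{N}
sin(πkn/(N+1)) |n⟩ with corresponding eigenvalues E_k = [∓]2cos(kπ/(N+1)) for all k = 1, …, N"
[cite: ChristandlEtAl2004, p. 2] (the printed sign of `E_k` is immaterial: `k ↦ N+1−k` maps the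
list onto itself; with `|0⟩ = ↓` and `T_{ab} = σ^+_aσ^-_b + σ^-_aσ^+_b` as here the block is `+A(G)`).

## Contents (all proved; 0 named facts; standard axioms)

* `exc v` — the single-excitation configuration `|v⟩` (`true` at `v`, `false` elsewhere);
  `pairWord Q a b`, `pauliString_pairWord_apply` (entries of a two-site string);
* `hop a b = ½(σ^x_aσ^x_b + σ^y_aσ^y_b)` with **`hop_apply`** (its entries: it moves one excitation
  across the pair and does nothing else), `hop_comm`, `hop_exc_exc`, **`hop_apply_exc`**
  (`T_{ab}|w⟩ = [w = a]|b⟩ + [w = b]|a⟩`);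
* `xyHam G = ½ Σ_{ordered adjacent (a,b)} T_{ab}` (`= ½ Σ_{edges} (σ^xσ^x + σ^yσ^y)`);
  **`xyHam_apply_exc`** (`H_G|w⟩ = Σ_{u ∼ w} |u⟩`), **`xyHam_exc_exc`** / **`xyHam_submatrix_exc`**
  (`⟨v|H_G|w⟩ = A(G)_{vw}` — the printed statement), `xyHam_apply_exc_of_forall_ne` (the block is
  invariant: columns at single excitations are supported on single excitations);
* `excNumber`, `numberOp` (`N̂`), `hop_apply_eq_zero_of_excNumber_ne`,
  **`xyHam_apply_eq_zero_of_excNumber_ne`**, **`xyHam_mul_numberOp_comm`** (`[H_G, N̂] = 0`, i.e.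
  `σ^z_tot` commutes with `H_G`: every excitation-number sector is invariant — the U(1) structure the
  lane's sector-blocked codes use, cf. `AbelianSectorDecomposition.lean`); `totalZ` (`σ^z_tot` as a sum
  of one-site Pauli strings), `totalZ_eq` (`σ^z_tot = |ι|·1 − 2N̂`), **`xyHam_mul_totalZ_comm`**
  (`[H_G, σ^z_tot] = 0`, the printed conservation law verbatim);
* `excLift u = Σ_v u(v)|v⟩` and **`xyHam_mulVec_excLift`** (`H_G|u⟩ = |A(G)u⟩`),
  `xyHam_pow_mulVec_excLift` (`H_G^m|u⟩ = |A(G)^m u⟩` — the quantum walk),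
  `xyHam_mulVec_excLift_of_eigen` (adjacency eigenvectors lift to one-particle eigenstates);
* `excEmbed` (`L`, the isometric embedding `u ↦ |u⟩`, `excEmbed_mulVec`, `excEmbed_transpose_mul_self`
  `LᵀL = 1`), `xyHam_mul_excEmbed` (`H_G L = L A(G)`), (private) `exp_liftConj`
  (`e^{L B Lᵀ} = (1 − LLᵀ) + L e^{B} Lᵀ`), **`exp_smul_xyHam_mul_excEmbed`** (`e^{zH_G} L = L e^{zA(G)}`)
  and **`exp_smul_xyHam_mulVec_excLift`** (`e^{zH_G}|u⟩ = |e^{zA(G)}u⟩` for every `z ∈ ℂ`, Mathlib's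
  `NormedSpace.exp`), **`exp_smul_xyHam_exc_exc`** (`⟨i|e^{zH_G}|j⟩ = (e^{zA(G)})_{ij}` — the printed
  `F(t) = ⟨N|e^{−itH_G}|1⟩`) and, with `PathSpectrum.lean`, **`exp_smul_xyHam_pathGraph_exc_exc`**
  (open chain: `⟨i|e^{zH}|j⟩ = (2/(n+1)) Σ_k sin((i+1)θ_k) e^{2z cos θ_k} sin((j+1)θ_k)` — the printed
  `F(t) = (2/(N+1)) Σ_k sin(πk/(N+1)) sin(πkN/(N+1)) e^{−iE_k t}` at `z = −it`);
* corollaries with `PathSpectrum.lean`: **`xyHam_pathGraph_mulVec_sineMode`** (open chain: the sine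
  modes `Σ_i sin((i+1)(k+1)π/(n+1))|i⟩` are eigenstates with energies `2cos((k+1)π/(n+1))`, the
  printed `|k̃⟩`, `E_k`) and `xyHam_grid_mulVec_sineMode` (open `m × n` grid: product sine modes,
  energies `2cos((a+1)π/(m+1)) + 2cos((b+1)π/(n+1))`).

Not covered: the edge-sum (`Sym2`) form of `H_G` (the ordered-pair form with the factor ½ is used;
`hop_comm` records the symmetry), Heisenberg / XXZ couplings (their one-excitation block has an
extra diagonal degree term), higher excitation sectors.

## References

* [ChristandlEtAl2004] M. Christandl, N. Datta, A. Ekert, A. J. Landahl, Phys. Rev. Lett. 92,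
  187902 (2004), doi:10.1103/PhysRevLett.92.187902 = arXiv:quant-ph/0309131, p. 2 (held text
  `paper:arxiv-quant-ph_0309131`, chunk p0002 L84–L87 (H_G) and p0003 L10–L56 (𝒮_G, restriction =
  A(G), chain eigenstates)).
* [BrouwerHaemers2012] A. E. Brouwer, W. H. Haemers, *Spectra of Graphs*, Springer 2012, §1.4.4,
  §1.4.6 — via `PathSpectrum.lean`.
-/

noncomputable section

namespace Literature.Computability.QuantumComplexity

open Finset Matrix

variable {ι : Type*} [Fintype ι] [DecidableEq ι]

/-! ### Single-excitation basis states and two-site strings -/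

/-- The single-excitation basis state `|v⟩`: all qubits `|0⟩` (`false`) except qubit `v` in `|1⟩`
("spin configurations in which all spins are 'down' apart from just one spin at the vertex n
which is 'up'"). [cite: ChristandlEtAl2004, p. 2 (the subspace 𝒮_G)] -/
def exc (v : ι) : ι → Bool := fun w => decide (w = v)

omit [Fintype ι] in
/-- Unfolding of `|v⟩`. [cite: ChristandlEtAl2004, p. 2 (the basis |n⟩ of 𝒮_G)] -/
@[simp] theorem exc_apply (v w : ι) : exc v w = decide (w = v) := rfl

omit [Fintype ι] in
/-- `|v⟩ = |w⟩` iff `v = w` (the `|n⟩` are `N` distinct basis vectors). [cite: ChristandlEtAl2004,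
p. 2 (the N-dimensional subspace 𝒮_G)] -/
theorem exc_injective : Function.Injective (exc (ι := ι)) := by
  intro v w h
  have := congr_fun h v
  simpa using this

/-- The two-site Pauli word with letter `Q` at the wires `a` and `b` and `I` elsewhere.
[cite: ChristandlEtAl2004, eq. (2) (σ^x_i σ^x_j, σ^y_i σ^y_j)] -/
def pairWord (Q : Pauli) (a b : ι) : ι → Pauli :=
  Function.update (Function.update (fun _ => Pauli.I) a Q) b Q

omit [Fintype ι] in
/-- Letter at the first wire. [folklore] -/
private theorem pairWord_apply_left (Q : Pauli) {a b : ι} : pairWord Q a b a = Q := by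
  unfold pairWord
  by_cases h : a = b
  · subst h; simp
  · rw [Function.update_of_ne h]; simp

omit [Fintype ι] in
/-- Letter at the second wire. [folklore] -/
private theorem pairWord_apply_right (Q : Pauli) (a b : ι) : pairWord Q a b b = Q := by
  simp [pairWord]

omit [Fintype ι] in
/-- Identity letter off the pair. [folklore] -/
private theorem pairWord_apply_of_ne (Q : Pauli) {a b i : ι} (ha : i ≠ a) (hb : i ≠ b) :
    pairWord Q a b i = Pauli.I := by
  simp [pairWord, Function.update_of_ne hb, Function.update_of_ne ha]

/-- Entries of a two-site string `σ^Q_a σ^Q_b`: the two slot factors times the Kronecker delta on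
the other wires. [cite: ChristandlEtAl2004, eq. (2) (the terms σ^x_iσ^x_j, σ^y_iσ^y_j)] -/
theorem pauliString_pairWord_apply (Q : Pauli) {a b : ι} (hab : a ≠ b) (x y : ι → Bool) :
    pauliString (pairWord Q a b) x y =
      Q.mat (x a) (y a) * Q.mat (x b) (y b) *
        (if ∀ i, i ≠ a → i ≠ b → x i = y i then 1 else 0) := by
  rw [pauliString_eq, tensorAll_apply]
  rw [← Finset.mul_prod_erase _ _ (mem_univ a), pairWord_apply_left,
    ← Finset.mul_prod_erase _ _ (mem_erase.2 ⟨hab.symm, mem_univ b⟩), pairWord_apply_right,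
    mul_assoc]
  congr 1
  have h1 : ∀ i ∈ (univ.erase a).erase b, (pairWord Q a b i).mat (x i) (y i) =
      if x i = y i then 1 else 0 := by
    intro i hi
    simp only [mem_erase, mem_univ, and_true] at hi
    rw [pairWord_apply_of_ne Q hi.2 hi.1]
    simp [Pauli.mat, Matrix.one_apply]
  rw [prod_congr rfl h1, prod_boole]
  have hiff : (∀ i ∈ (univ.erase a).erase b, x i = y i) ↔ (∀ i, i ≠ a → i ≠ b → x i = y i) := by
    simp only [mem_erase, mem_univ, and_true]
    exact ⟨fun h i hia hib => h i ⟨hib, hia⟩, fun h i hi => h i hi.2 hi.1⟩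
  simp only [hiff]

/-- The hopping term on the pair `{a, b}`: `T_{ab} = ½ (σ^x_a σ^x_b + σ^y_a σ^y_b)`
(`= σ^+_a σ^-_b + σ^-_a σ^+_b`). [cite: ChristandlEtAl2004, eq. (2)] -/
def hop (a b : ι) : Matrix (ι → Bool) (ι → Bool) ℂ :=
  (1 / 2 : ℂ) • (pauliString (pairWord Pauli.X a b) + pauliString (pairWord Pauli.Y a b))

/-- **Entries of the hopping term**: `(T_{ab})_{xy} = 1` exactly when `x` carries one excitation on
the pair (`x_a ≠ x_b`), `y` is `x` with that excitation moved across the pair, and `x`, `y` agree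
off the pair; otherwise `0` (`T_{ab} = σ^+_a σ^-_b + σ^-_a σ^+_b`). [cite: ChristandlEtAl2004,
eq. (2) and p. 2] -/
theorem hop_apply {a b : ι} (hab : a ≠ b) (x y : ι → Bool) :
    hop a b x y =
      if (x a ≠ y a ∧ x b ≠ y b ∧ x a ≠ x b ∧ ∀ i, i ≠ a → i ≠ b → x i = y i) then 1 else 0 := by
  rw [hop, Matrix.smul_apply, Matrix.add_apply, pauliString_pairWord_apply _ hab,
    pauliString_pairWord_apply _ hab, smul_eq_mul]
  generalize x a = xa
  generalize y a = ya
  generalize x b = xb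
  generalize y b = yb
  cases xa <;> cases ya <;> cases xb <;> cases yb <;>
    simp [Pauli.mat] <;> split_ifs <;> ring_nf

/-- **Matrix elements of the hopping term between single excitations**: for `a ≠ b`,
`⟨v| T_{ab} |w⟩ = 1` if `(a, b) = (v, w)` or `(a, b) = (w, v)`, and `0` otherwise — the term moves
the excitation along the pair and does nothing else. [cite: ChristandlEtAl2004, p. 2] -/
theorem hop_exc_exc {a b : ι} (hab : a ≠ b) (v w : ι) :
    hop a b (exc v) (exc w) = if (a = v ∧ b = w) ∨ (a = w ∧ b = v) then 1 else 0 := by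
  rw [hop_apply hab]
  simp only [exc_apply]
  by_cases hav : a = v <;> by_cases haw : a = w <;> by_cases hbv : b = v <;> by_cases hbw : b = w
  all_goals first
    | (exfalso; subst_vars; exact hab rfl)
    | skip
  all_goals simp +contextual [hav, haw, hbv, hbw]
  all_goals first
    | exact ⟨fun h => haw (hav.trans h), fun h => haw (hav.trans h.symm)⟩
    | exact ⟨fun h => hav (haw.trans h), fun h => hav (haw.trans h.symm)⟩

/-- The hopping term is symmetric in the pair (so each undirected edge of eq. (2) is `T_{ab} + T_{ba}
= 2T_{ab}` in the ordered-pair sum). [cite: ChristandlEtAl2004, eq. (2)] -/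
theorem hop_comm (a b : ι) : hop a b = hop b a := by
  unfold hop pairWord
  by_cases h : a = b
  · subst h; rfl
  · rw [Function.update_comm h, Function.update_comm (Ne.symm h)]
    simp [Function.update_comm h]

/-- **A column of the hopping term at a single excitation**: `T_{ab} |w⟩ = |b⟩` if `w = a`, `|a⟩` if
`w = b`, and `0` if `w ∉ {a, b}`; as entries, `(T_{ab})_{x, |w⟩} = 1` iff
`(a = w ∧ x = |b⟩) ∨ (b = w ∧ x = |a⟩)`. [cite: ChristandlEtAl2004, p. 2] -/
theorem hop_apply_exc {a b : ι} (hab : a ≠ b) (x : ι → Bool) (w : ι) :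
    hop a b x (exc w) = if (a = w ∧ x = exc b) ∨ (b = w ∧ x = exc a) then 1 else 0 := by
  rw [hop_apply hab]
  have hba : b ≠ a := Ne.symm hab
  apply if_congr _ rfl rfl
  simp only [exc_apply, ne_eq]
  constructor
  · rintro ⟨h1, h2, h3, h4⟩
    rcases Bool.eq_false_or_eq_true (x a) with hxa | hxa
    · -- the excitation sits at `a`: then `b = w` and `x = |a⟩`
      have hxb : x b = false := by
        cases h : x b
        · rfl
        · exact absurd (hxa.trans h.symm) h3
      have hbw : b = w := by
        by_contra h
        apply h2; rw [hxb]; simp [h]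
      refine Or.inr ⟨hbw, funext fun i => ?_⟩
      by_cases hia : i = a
      · subst hia; simp [hxa]
      · by_cases hib : i = b
        · subst hib; simp [hxb, hba]
        · rw [h4 i hia hib]
          have hiw : i ≠ w := fun h => hib (h.trans hbw.symm)
          simp [hiw, hia]
    · -- the excitation sits at `b`
      have hxb : x b = true := by
        cases h : x b
        · exact absurd (hxa.trans h.symm) h3
        · rfl
      have haw : a = w := by
        by_contra h
        apply h1; rw [hxa]; simp [h]
      refine Or.inl ⟨haw, funext fun i => ?_⟩
      by_cases hib : i = b
      · subst hib; simp [hxb]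
      · by_cases hia : i = a
        · subst hia; simp [hxa, hab]
        · rw [h4 i hia hib]
          have hiw : i ≠ w := fun h => hia (h.trans haw.symm)
          simp [hiw, hib]
  · rintro (⟨rfl, rfl⟩ | ⟨rfl, rfl⟩)
    · refine ⟨by simp [hab], by simp [hba], by simp [hab], fun i hia hib => ?_⟩
      simp [hia, hib]
    · refine ⟨by simp [hab], by simp [hba], by simp [hba], fun i hia hib => ?_⟩
      simp [hia, hib]

/-! ### The XY network Hamiltonian and its single-excitation block -/

variable (G : _root_.SimpleGraph ι) [DecidableRel G.Adj]

/-- **The XY network Hamiltonian** of a graph `G` on the wire set: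
`H_G = ½ Σ_{(i,j) ∈ E(G)} (σ^x_i σ^x_j + σ^y_i σ^y_j)`, written as `½ Σ_{ordered adjacent (a,b)} T_{ab}`
(each edge contributes `T_{ab} + T_{ba} = 2 T_{ab} = σ^xσ^x + σ^yσ^y` by `hop_comm`).
[cite: ChristandlEtAl2004, eq. (2)] -/
def xyHam : Matrix (ι → Bool) (ι → Bool) ℂ :=
  (1 / 2 : ℂ) • ∑ a, ∑ b, if G.Adj a b then hop a b else 0

/-- **A column of `H_G` at a single excitation is the lifted column of the adjacency matrix**:
`(H_G)_{x, |w⟩} = Σ_{u ∼ w} [x = |u⟩]`, i.e. `H_G |w⟩ = Σ_{u ∼ w} |u⟩` ("the dynamics are effectively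
confined to the subspace 𝒮_G"). [cite: ChristandlEtAl2004, p. 2] -/
theorem xyHam_apply_exc (x : ι → Bool) (w : ι) :
    xyHam G x (exc w) = ∑ u ∈ G.neighborFinset w, if x = exc u then 1 else 0 := by
  unfold xyHam
  rw [Matrix.smul_apply, smul_eq_mul, Matrix.sum_apply]
  simp_rw [Matrix.sum_apply]
  have hterm : ∀ a b, (if G.Adj a b then hop a b else 0) x (exc w) =
      (if G.Adj a b ∧ a = w ∧ x = exc b then 1 else 0) +
        (if G.Adj a b ∧ b = w ∧ x = exc a then 1 else 0) := by
    intro a b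
    by_cases hadj : G.Adj a b
    · rw [if_pos hadj, hop_apply_exc (G.ne_of_adj hadj)]
      have hab := G.ne_of_adj hadj
      by_cases h1 : a = w ∧ x = exc b
      · have h2 : ¬(b = w ∧ x = exc a) := fun h => hab (h1.1.trans h.1.symm)
        rw [if_pos (Or.inl h1), if_pos ⟨hadj, h1⟩, if_neg (fun h => h2 h.2), add_zero]
      · by_cases h2 : b = w ∧ x = exc a
        · rw [if_pos (Or.inr h2), if_neg (fun h => h1 h.2), if_pos ⟨hadj, h2⟩, zero_add]
        · rw [if_neg (by rintro (h | h); exacts [h1 h, h2 h]), if_neg (fun h => h1 h.2),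
            if_neg (fun h => h2 h.2), add_zero]
    · rw [if_neg hadj, Matrix.zero_apply, if_neg (fun h => hadj h.1), if_neg (fun h => hadj h.1),
        add_zero]
  simp_rw [hterm, sum_add_distrib]
  -- first double sum: a = w, b ranges over neighbours of w
  have hA : ∑ a, ∑ b, (if G.Adj a b ∧ a = w ∧ x = exc b then (1 : ℂ) else 0) =
      ∑ u ∈ G.neighborFinset w, if x = exc u then 1 else 0 := by
    rw [Finset.sum_eq_single w]
    · rw [← sum_filter_add_sum_filter_not univ (fun b => G.Adj w b)]
      have h0 : ∑ b ∈ univ.filter (fun b => ¬G.Adj w b),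
          (if G.Adj w b ∧ w = w ∧ x = exc b then (1 : ℂ) else 0) = 0 :=
        sum_eq_zero fun b hb => by
          simp only [mem_filter, mem_univ, true_and] at hb; simp [hb]
      rw [h0, add_zero, G.neighborFinset_eq_filter (v := w)]
      refine sum_congr rfl fun b hb => ?_
      simp only [mem_filter, mem_univ, true_and] at hb
      simp [hb]
    · intro a _ haw
      exact sum_eq_zero fun b _ => by simp [haw]
    · intro h; exact absurd (mem_univ w) h
  -- second double sum: b = w, a ranges over neighbours of w
  have hB : ∑ a, ∑ b, (if G.Adj a b ∧ b = w ∧ x = exc a then (1 : ℂ) else 0) =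
      ∑ u ∈ G.neighborFinset w, if x = exc u then 1 else 0 := by
    rw [Finset.sum_comm, Finset.sum_eq_single w]
    · rw [← sum_filter_add_sum_filter_not univ (fun a => G.Adj w a)]
      have h0 : ∑ a ∈ univ.filter (fun a => ¬G.Adj w a),
          (if G.Adj a w ∧ w = w ∧ x = exc a then (1 : ℂ) else 0) = 0 :=
        sum_eq_zero fun a ha => by
          simp only [mem_filter, mem_univ, true_and] at ha
          have : ¬G.Adj a w := fun h => ha h.symm
          simp [this]
      rw [h0, add_zero, G.neighborFinset_eq_filter (v := w)]
      refine sum_congr rfl fun a ha => ?_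
      simp only [mem_filter, mem_univ, true_and] at ha
      simp [ha.symm]
    · intro b _ hbw
      exact sum_eq_zero fun a _ => by simp [hbw]
    · intro h; exact absurd (mem_univ w) h
  rw [hA, hB, ← two_mul, ← mul_assoc]
  norm_num

/-- **"The Hamiltonian H_G, when restricted to this subspace, is represented by an N × N matrix that
is identical to the adjacency matrix A(G)"**: `⟨v| H_G |w⟩ = [v ∼ w]`.
[cite: ChristandlEtAl2004, p. 2] -/
theorem xyHam_exc_exc (v w : ι) : xyHam G (exc v) (exc w) = G.adjMatrix ℂ v w := by
  rw [xyHam_apply_exc, SimpleGraph.adjMatrix_apply]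
  simp only [exc_injective.eq_iff]
  rw [sum_ite_eq]
  simp [SimpleGraph.mem_neighborFinset, G.adj_comm]

/-- The same as a matrix identity: the single-excitation block of `H_G` IS `A(G)`.
[cite: ChristandlEtAl2004, p. 2] -/
theorem xyHam_submatrix_exc : (xyHam G).submatrix exc exc = G.adjMatrix ℂ := by
  ext v w
  rw [submatrix_apply, xyHam_exc_exc]

/-- **Invariance of the single-excitation subspace**: the column of `H_G` at `|w⟩` is supported on
single excitations — `(H_G)_{x,|w⟩} = 0` unless `x = |u⟩` for some `u` (conservation of
`σ^z_tot`, "the dynamics are effectively confined to the subspace 𝒮_G").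
[cite: ChristandlEtAl2004, p. 2] -/
theorem xyHam_apply_exc_of_forall_ne {x : ι → Bool} (hx : ∀ u, x ≠ exc u) (w : ι) :
    xyHam G x (exc w) = 0 := by
  rw [xyHam_apply_exc]
  exact sum_eq_zero fun u _ => if_neg (hx u)

/-! ### Conservation of the excitation number (`σ^z_tot` commutes with `H_G`) -/

omit [DecidableEq ι] in
/-- The excitation number of a configuration: the number of wires in `|1⟩` (`N̂ = Σ_i (1 − σ^z_i)/2`,
so `σ^z_tot = |ι| − 2N̂`). [cite: ChristandlEtAl2004, p. 2 (σ^z_tot)] -/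
def excNumber (x : ι → Bool) : ℕ := (univ.filter fun i => x i = true).card

omit [DecidableEq ι] in
/-- The excitation number as a sum of indicators. [cite: ChristandlEtAl2004, p. 2] -/
theorem excNumber_eq_sum (x : ι → Bool) : excNumber x = ∑ i, if x i = true then 1 else 0 := by
  rw [excNumber, Finset.card_filter]

omit [Fintype ι] [DecidableEq ι] in
/-- A single excitation has excitation number one. [cite: ChristandlEtAl2004, p. 2] -/
theorem excNumber_exc [Fintype ι] [DecidableEq ι] (v : ι) : excNumber (exc v) = 1 := by
  rw [excNumber]
  have : (univ.filter fun i => exc v i = true) = {v} := by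
    ext i; simp
  rw [this, card_singleton]

/-- **The hopping term conserves the excitation number**: `(T_{ab})_{xy} = 0` unless `x` and `y`
carry the same number of excitations (it swaps one `|1⟩` and one `|0⟩` on the pair).
[cite: ChristandlEtAl2004, p. 2 ("σ^z_tot … commutes with H_G")] -/
theorem hop_apply_eq_zero_of_excNumber_ne {a b : ι} (hab : a ≠ b) {x y : ι → Bool}
    (hne : excNumber x ≠ excNumber y) : hop a b x y = 0 := by
  rw [hop_apply hab]
  refine if_neg fun ⟨h1, h2, h3, h4⟩ => hne ?_
  rw [excNumber_eq_sum, excNumber_eq_sum,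
    ← Finset.add_sum_erase _ _ (mem_univ a), ← Finset.add_sum_erase _ _ (mem_univ a),
    ← Finset.add_sum_erase _ _ (mem_erase.2 ⟨hab.symm, mem_univ b⟩),
    ← Finset.add_sum_erase _ _ (mem_erase.2 ⟨hab.symm, mem_univ b⟩)]
  have hrest : ∑ i ∈ (univ.erase a).erase b, (if x i = true then 1 else 0) =
      ∑ i ∈ (univ.erase a).erase b, (if y i = true then 1 else 0) := by
    refine sum_congr rfl fun i hi => ?_
    simp only [mem_erase, mem_univ, and_true] at hi
    rw [h4 i hi.2 hi.1]
  rw [hrest, ← add_assoc, ← add_assoc]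
  congr 1
  -- on the pair: `x` has exactly one excitation and `y` the complementary pattern
  revert h1 h2 h3
  cases x a <;> cases x b <;> cases y a <;> cases y b <;> simp

/-- Hence **`H_G` conserves the excitation number**: `(H_G)_{xy} = 0` whenever
`N̂(x) ≠ N̂(y)` — every excitation-number sector is invariant ("the conservation of the total
z-component of spin"). [cite: ChristandlEtAl2004, p. 2] -/
theorem xyHam_apply_eq_zero_of_excNumber_ne {x y : ι → Bool} (hne : excNumber x ≠ excNumber y) :
    xyHam G x y = 0 := by
  unfold xyHam
  rw [Matrix.smul_apply, smul_eq_mul, Matrix.sum_apply]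
  simp_rw [Matrix.sum_apply]
  rw [sum_eq_zero fun a _ => sum_eq_zero fun b _ => ?_, mul_zero]
  by_cases hadj : G.Adj a b
  · rw [if_pos hadj]; exact hop_apply_eq_zero_of_excNumber_ne (G.ne_of_adj hadj) hne
  · rw [if_neg hadj]; rfl

/-- The number operator `N̂ = diag(excNumber)` on the register. [cite: ChristandlEtAl2004, p. 2
(σ^z_tot = |ι|·1 − 2N̂)] -/
def numberOp : Matrix (ι → Bool) (ι → Bool) ℂ := diagonal fun x => (excNumber x : ℂ)

/-- **`[H_G, N̂] = 0`** (equivalently `[H_G, σ^z_tot] = 0`): the XY network Hamiltonian commutes with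
the excitation number, so its dynamics is block diagonal over the sectors `N̂ = 0, 1, …, |ι|` — the
`N̂ = 1` block being `A(G)` (`xyHam_submatrix_exc`). [cite: ChristandlEtAl2004, p. 2] -/
theorem xyHam_mul_numberOp_comm : xyHam G * numberOp = numberOp * xyHam G := by
  ext x y
  rw [numberOp, mul_diagonal, diagonal_mul]
  by_cases h : excNumber x = excNumber y
  · rw [h, mul_comm]
  · rw [xyHam_apply_eq_zero_of_excNumber_ne G h, zero_mul, mul_zero]

/-- The total magnetisation operator `σ^z_tot = Σ_i σ^z_i` on the register, as a sum of one-site Pauli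
strings. [cite: ChristandlEtAl2004, p. 2 (σ^z_tot := Σ_{i ∈ V(G)} σ^z_i)] -/
def totalZ : Matrix (ι → Bool) (ι → Bool) ℂ :=
  ∑ i, pauliString (Function.update (fun _ : ι => Pauli.I) i Pauli.Z)

/-- Entries of a one-site `σ^z_i`: diagonal, `+1` on `|0⟩_i` and `−1` on `|1⟩_i`. [folklore] -/
private theorem pauliString_single_Z_apply (i : ι) (x y : ι → Bool) :
    pauliString (Function.update (fun _ : ι => Pauli.I) i Pauli.Z) x y =
      if x = y then (if x i = true then -1 else 1) else 0 := by
  rw [pauliString_update_const, tensorAll_update_apply, Pauli.mat_Z_apply]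
  simp only [Matrix.one_apply]
  rw [Finset.prod_boole]
  by_cases hxy : x = y
  · subst hxy
    simp
  · have hex : ∃ k, x k ≠ y k := by
      by_contra h
      exact hxy (funext fun k => by by_contra hk; exact h ⟨k, hk⟩)
    obtain ⟨k, hk⟩ := hex
    rw [if_neg hxy]
    by_cases hki : k = i
    · subst hki
      rw [if_neg hk, zero_mul]
    · have hne : ¬ ∀ k' ∈ univ.erase i, x k' = y k' :=
        fun h => hk (h k (mem_erase.2 ⟨hki, mem_univ k⟩))
      rw [if_neg hne, mul_zero]

/-- **`σ^z_tot = |ι|·1 − 2·N̂`**: the total magnetisation is an affine function of the excitation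
number (each `σ^z_i = 1 − 2 n̂_i`). [cite: ChristandlEtAl2004, p. 2] -/
theorem totalZ_eq : (totalZ : Matrix (ι → Bool) (ι → Bool) ℂ) =
    (Fintype.card ι : ℂ) • (1 : Matrix (ι → Bool) (ι → Bool) ℂ) - (2 : ℂ) • numberOp := by
  ext x y
  rw [totalZ, Matrix.sum_apply, Matrix.sub_apply, Matrix.smul_apply, Matrix.smul_apply, numberOp,
    diagonal_apply, Matrix.one_apply, smul_eq_mul, smul_eq_mul]
  simp_rw [pauliString_single_Z_apply]
  by_cases hxy : x = y
  · subst hxy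
    simp only [if_true, mul_one]
    rw [excNumber_eq_sum]
    have h : ∀ i : ι, ((if x i = true then (-1 : ℂ) else 1)) = 1 - 2 * (if x i = true then 1 else 0) :=
      fun i => by split_ifs <;> norm_num
    simp_rw [h]
    rw [sum_sub_distrib, sum_const, card_univ, nsmul_eq_mul, mul_one, ← mul_sum]
    push_cast
    rfl
  · simp [hxy]

/-- **`[H_G, σ^z_tot] = 0`** — literally the printed conservation law ("The operator of the total
z-component of the spin … commutes with H_G"). [cite: ChristandlEtAl2004, p. 2] -/
theorem xyHam_mul_totalZ_comm : xyHam G * totalZ = totalZ * xyHam G := by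
  rw [totalZ_eq, Matrix.mul_sub, Matrix.sub_mul, Matrix.mul_smul, Matrix.smul_mul, Matrix.mul_one,
    Matrix.one_mul, Matrix.mul_smul, Matrix.smul_mul, xyHam_mul_numberOp_comm]

/-! ### One-particle wave functions: `H_G` acts on them as `A(G)` -/

/-- The single-excitation state with one-particle wave function `u : ι → ℂ`:
`|u⟩ := Σ_v u(v) |v⟩`, as a vector on the register. [cite: ChristandlEtAl2004, p. 2
(`Σ_n β_n(t) |n⟩`)] -/
def excLift (u : ι → ℂ) : (ι → Bool) → ℂ := fun x => ∑ v, if x = exc v then u v else 0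

omit [DecidableEq ι] in
/-- `|u⟩` evaluated at a single excitation returns the wave function (`β_n`).
[cite: ChristandlEtAl2004, p. 2 (`Σ_n β_n(t)|n⟩`)] -/
theorem excLift_exc [DecidableEq ι] (u : ι → ℂ) (v : ι) : excLift u (exc v) = u v := by
  unfold excLift
  simp only [exc_injective.eq_iff]
  rw [sum_ite_eq]; simp

omit [DecidableEq ι] in
/-- `|u⟩` vanishes off the single-excitation configurations (it lies in 𝒮_G).
[cite: ChristandlEtAl2004, p. 2] -/
theorem excLift_of_forall_ne [DecidableEq ι] (u : ι → ℂ) {x : ι → Bool} (hx : ∀ v, x ≠ exc v) :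
    excLift u x = 0 :=
  sum_eq_zero fun v _ => if_neg (hx v)

/-- **`H_G |u⟩ = |A(G) u⟩`**: on one-particle states the XY Hamiltonian acts as the adjacency
matrix (the continuous-time quantum walk on `G`). [cite: ChristandlEtAl2004, p. 2] -/
theorem xyHam_mulVec_excLift (u : ι → ℂ) :
    xyHam G *ᵥ excLift u = excLift (G.adjMatrix ℂ *ᵥ u) := by
  funext x
  rw [mulVec, dotProduct]
  -- only single-excitation columns contribute
  have h1 : ∑ y, xyHam G x y * excLift u y = ∑ w, xyHam G x (exc w) * u w := by
    unfold excLift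
    simp_rw [mul_sum, mul_ite, mul_zero]
    rw [sum_comm]
    refine sum_congr rfl fun w _ => ?_
    rw [sum_ite_eq']; simp
  rw [h1]
  by_cases hx : ∃ v, x = exc v
  · obtain ⟨v, rfl⟩ := hx
    simp_rw [xyHam_exc_exc]
    rw [excLift_exc, mulVec, dotProduct]
  · have hx' : ∀ v, x ≠ exc v := fun v h => hx ⟨v, h⟩
    simp_rw [xyHam_apply_exc_of_forall_ne G hx']
    rw [excLift_of_forall_ne _ hx']
    simp

/-- … hence for every power: `H_G^m |u⟩ = |A(G)^m u⟩` — the whole one-particle dynamics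
(`e^{−itH_G}|u⟩ = |e^{−itA(G)}u⟩` term by term; "one may express the time evolution of the network in
the 𝒮_G subspace as a continuous-time quantum walk on G"). [cite: ChristandlEtAl2004, p. 2] -/
theorem xyHam_pow_mulVec_excLift (u : ι → ℂ) (m : ℕ) :
    (xyHam G ^ m) *ᵥ excLift u = excLift ((G.adjMatrix ℂ ^ m) *ᵥ u) := by
  induction m generalizing u with
  | zero => simp
  | succ m ih => rw [pow_succ', ← mulVec_mulVec, ih, xyHam_mulVec_excLift, mulVec_mulVec, ← pow_succ']

/-- **Eigenvectors transfer**: if `A(G) u = θ u` then `H_G |u⟩ = θ |u⟩` (one-magnon / one-particle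
eigenstates of the XY network are the lifted adjacency eigenvectors). [cite: ChristandlEtAl2004,
p. 2] -/
theorem xyHam_mulVec_excLift_of_eigen {u : ι → ℂ} {θ : ℂ} (hu : G.adjMatrix ℂ *ᵥ u = θ • u) :
    xyHam G *ᵥ excLift u = θ • excLift u := by
  rw [xyHam_mulVec_excLift, hu]
  funext x
  simp only [excLift, Pi.smul_apply, smul_eq_mul, mul_sum, mul_ite, mul_zero]

/-! ### Propagators: `e^{zH_G}` acts on the one-particle subspace as `e^{zA(G)}` -/

section Propagator

open NormedSpace

/-- The isometric embedding of one-particle wave functions into the register: `L_{x,v} = [x = |v⟩]`,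
so that `excLift u = L u`. [cite: ChristandlEtAl2004, p. 2 (the subspace 𝒮_G)] -/
def excEmbed : Matrix (ι → Bool) ι ℂ := Matrix.of fun x v => if x = exc v then 1 else 0

/-- `L u = |u⟩`. [cite: ChristandlEtAl2004, p. 2] -/
theorem excEmbed_mulVec (u : ι → ℂ) : excEmbed *ᵥ u = excLift u := by
  funext x
  simp only [excEmbed, excLift, mulVec, dotProduct, of_apply, ite_mul, one_mul, zero_mul]

/-- `Lᵀ L = 1`: the single excitations are orthonormal. [cite: ChristandlEtAl2004, p. 2] -/
theorem excEmbed_transpose_mul_self :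
    (excEmbed : Matrix (ι → Bool) ι ℂ)ᵀ * (excEmbed : Matrix (ι → Bool) ι ℂ) = (1 : Matrix ι ι ℂ) := by
  ext v w
  simp only [mul_apply, transpose_apply, excEmbed, of_apply, mul_ite, mul_one, mul_zero,
    one_apply]
  by_cases h : v = w
  · subst h
    simp only [if_true]
    have : ∀ x : ι → Bool, (if x = exc v then (if x = exc v then (1 : ℂ) else 0) else 0) =
        if x = exc v then 1 else 0 := fun x => by split_ifs <;> rfl
    simp_rw [this]
    rw [Finset.sum_ite_eq' univ (exc v)]
    simp
  · rw [if_neg h]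
    refine sum_eq_zero fun x _ => ?_
    by_cases hx : x = exc w
    · subst hx
      rw [if_pos rfl, if_neg (fun h' => h (exc_injective h'.symm))]
    · rw [if_neg hx]


/-- The intertwining relation **`H_G L = L A(G)`** (matrix form of `xyHam_mulVec_excLift`).
[cite: ChristandlEtAl2004, p. 2] -/
theorem xyHam_mul_excEmbed : xyHam G * excEmbed = excEmbed * G.adjMatrix ℂ := by
  ext x v
  rw [mul_apply, mul_apply]
  simp only [excEmbed, of_apply, mul_ite, mul_one, mul_zero, ite_mul, one_mul, zero_mul]
  rw [Finset.sum_ite_eq' univ (exc v)]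
  simp only [mem_univ, if_true]
  rw [xyHam_apply_exc, G.neighborFinset_eq_filter (v := v), sum_filter]
  refine sum_congr rfl fun w _ => ?_
  rw [SimpleGraph.adjMatrix_apply]
  by_cases h1 : x = exc w <;> by_cases h2 : G.Adj v w <;> simp [h1, h2, G.adj_comm]

omit [DecidableEq ι] in
/-- Powers of a lifted operator: `(L B Lᵀ)^{n+1} = L B^{n+1} Lᵀ`. [folklore] -/
private theorem liftConj_pow_succ [DecidableEq ι] (B : Matrix ι ι ℂ) (n : ℕ) :
    (excEmbed * B * (excEmbed (ι := ι))ᵀ) ^ (n + 1) = excEmbed * B ^ (n + 1) * excEmbedᵀ := by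
  induction n with
  | zero => simp
  | succ n ih =>
    rw [pow_succ, ih, show B ^ (n + 1 + 1) = B ^ (n + 1) * B from pow_succ _ _]
    simp only [Matrix.mul_assoc]
    rw [← Matrix.mul_assoc excEmbedᵀ excEmbed, excEmbed_transpose_mul_self, Matrix.one_mul]

set_option backward.isDefEq.respectTransparency false in
/-- **The exponential of a lifted operator**: `e^{L B Lᵀ} = (1 − L Lᵀ) + L e^{B} Lᵀ` — identity off
the one-particle subspace, `e^{B}` on it. [folklore] -/
private theorem exp_liftConj (B : Matrix ι ι ℂ) :
    exp (excEmbed * B * (excEmbed (ι := ι))ᵀ) =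
      (1 - excEmbed * excEmbedᵀ) + excEmbed * exp B * excEmbedᵀ := by
  open scoped Matrix.Norms.Operator in
  -- the conjugation map as a continuous additive map
  let g : Matrix ι ι ℂ →+ Matrix (ι → Bool) (ι → Bool) ℂ :=
    { toFun := fun X => excEmbed * X * excEmbedᵀ
      map_zero' := by simp
      map_add' := fun X Y => by simp [Matrix.mul_add, Matrix.add_mul] }
  have hg : Continuous g :=
    (continuous_const.matrix_mul continuous_id).matrix_mul continuous_const
  have h1 : HasSum (fun n => (n.factorial⁻¹ : ℚ) • B ^ n) (exp B) :=
    exp_series_hasSum_exp' (𝕂 := ℚ) B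
  have h2 := h1.map g hg
  have h3 : HasSum (fun n => ((n.factorial⁻¹ : ℚ) • (excEmbed * B * excEmbedᵀ) ^ n))
      (exp (excEmbed * B * excEmbedᵀ)) := exp_series_hasSum_exp' (𝕂 := ℚ) _
  have h4 : HasSum (fun n : ℕ => if n = 0 then (1 : Matrix (ι → Bool) (ι → Bool) ℂ) -
      excEmbed * excEmbedᵀ else 0) (1 - excEmbed * excEmbedᵀ) := hasSum_ite_eq 0 _
  have hfun : (fun n => ((n.factorial⁻¹ : ℚ) • (excEmbed * B * (excEmbed (ι := ι))ᵀ) ^ n)) =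
      fun n => (if n = 0 then (1 : Matrix (ι → Bool) (ι → Bool) ℂ) - excEmbed * excEmbedᵀ else 0)
        + (g ∘ fun n => (n.factorial⁻¹ : ℚ) • B ^ n) n := by
    funext n
    cases n with
    | zero => simp [g]
    | succ n =>
      rw [liftConj_pow_succ]
      simp [g, Matrix.smul_mul, Matrix.mul_smul]
  rw [hfun] at h3
  exact h3.unique (h4.add h2)

set_option backward.isDefEq.respectTransparency false in
/-- **`e^{zH_G} L = L e^{zA(G)}`**: the XY propagator acts on the one-particle subspace as the
propagator of the adjacency matrix (`e^{−itH_G}` = continuous-time quantum walk `e^{−itA(G)}` on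
`𝒮_G`). [cite: ChristandlEtAl2004, p. 2] -/
theorem exp_smul_xyHam_mul_excEmbed (z : ℂ) :
    exp (z • xyHam G) * excEmbed = excEmbed * exp (z • G.adjMatrix ℂ) := by
  open scoped Matrix.Norms.Operator in
  set L : Matrix (ι → Bool) ι ℂ := excEmbed with hL
  set P : Matrix (ι → Bool) (ι → Bool) ℂ := L * Lᵀ with hP
  set Az : Matrix (ι → Bool) (ι → Bool) ℂ := L * (z • G.adjMatrix ℂ) * Lᵀ with hAz
  have hLL : Lᵀ * L = 1 := excEmbed_transpose_mul_self
  have hPL : P * L = L := by rw [hP, Matrix.mul_assoc, hLL, Matrix.mul_one]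
  have hHL : z • xyHam G * L = L * (z • G.adjMatrix ℂ) := by
    rw [Matrix.smul_mul, xyHam_mul_excEmbed, Matrix.mul_smul]
  -- semiconjugacy `P · Az = (zH) · P`
  have hsemi : SemiconjBy P Az (z • xyHam G) := by
    show P * Az = z • xyHam G * P
    rw [hAz, ← Matrix.mul_assoc, ← Matrix.mul_assoc, hPL, hP, ← Matrix.mul_assoc, hHL]
  have hsemiExp : SemiconjBy P (exp Az) (exp (z • xyHam G)) := by
    rw [exp_eq_tsum_rat]
    exact SemiconjBy.tsum_right P (expSeries_summable' Az) (expSeries_summable' _)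
      fun n => (hsemi.pow_right n).smul_right _
  -- assemble
  calc exp (z • xyHam G) * L = exp (z • xyHam G) * P * L := by rw [Matrix.mul_assoc, hPL]
    _ = P * exp Az * L := by rw [hsemiExp.eq]
    _ = P * ((1 - L * Lᵀ) + L * exp (z • G.adjMatrix ℂ) * Lᵀ) * L := by rw [hAz, exp_liftConj]
    _ = L * exp (z • G.adjMatrix ℂ) := by
      have hPP : P * P = P := by
        rw [hP, Matrix.mul_assoc, ← Matrix.mul_assoc Lᵀ L, hLL, Matrix.one_mul]
      rw [Matrix.mul_add, Matrix.add_mul, Matrix.mul_sub, Matrix.sub_mul, Matrix.mul_one, hPL,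
        ← hP, hPP, hPL, sub_self, zero_add]
      simp only [Matrix.mul_assoc, hLL, Matrix.mul_one]
      rw [← Matrix.mul_assoc, hPL]

/-- **`e^{zH_G}|u⟩ = |e^{zA(G)}u⟩`** for every `z ∈ ℂ` (in particular `z = −it`): one-particle states
evolve under the XY network Hamiltonian exactly as under the adjacency matrix.
[cite: ChristandlEtAl2004, p. 2 ("F(t) = ⟨N|e^{−itH_G}|1⟩", the quantum walk on G)] -/
theorem exp_smul_xyHam_mulVec_excLift (z : ℂ) (u : ι → ℂ) :
    exp (z • xyHam G) *ᵥ excLift u = excLift (exp (z • G.adjMatrix ℂ) *ᵥ u) := by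
  rw [← excEmbed_mulVec, ← excEmbed_mulVec, mulVec_mulVec, exp_smul_xyHam_mul_excEmbed,
    ← mulVec_mulVec]

/-- **`⟨i| e^{zH_G} |j⟩ = (e^{zA(G)})_{ij}`**: transition amplitudes between single excitations are the
entries of the adjacency propagator ("F(t) = ⟨N|e^{−itH_G}|1⟩ … one may express the time evolution
of the network in the 𝒮_G subspace as a continuous-time quantum walk on G").
[cite: ChristandlEtAl2004, p. 2] -/
theorem exp_smul_xyHam_exc_exc (z : ℂ) (i j : ι) :
    exp (z • xyHam G) (exc i) (exc j) = exp (z • G.adjMatrix ℂ) i j := by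
  have h := congr_fun (congr_fun (exp_smul_xyHam_mul_excEmbed G z) (exc i)) j
  rw [mul_apply, mul_apply] at h
  simp only [excEmbed, of_apply, mul_ite, mul_one, mul_zero, ite_mul, one_mul, zero_mul,
    exc_injective.eq_iff] at h
  rw [Finset.sum_ite_eq' univ (exc j), Finset.sum_ite_eq univ i] at h
  simpa using h

end Propagator

end Literature.Computability.QuantumComplexity

/-! ### The open chain: one-magnon eigenstates of the XY chain are the sine modes -/

namespace Literature.Computability.QuantumComplexity

open Finset Matrix Literature.Combinatorics.SimpleGraph

/-- Real adjacency eigenvectors give complex ones. [folklore] -/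
private theorem adjMatrix_complex_mulVec_of_real {V : Type*} [Fintype V] [DecidableEq V]
    (G : _root_.SimpleGraph V) [DecidableRel G.Adj] {u : V → ℝ} {θ : ℝ}
    (hu : G.adjMatrix ℝ *ᵥ u = θ • u) :
    G.adjMatrix ℂ *ᵥ (fun v => (u v : ℂ)) = (θ : ℂ) • fun v => (u v : ℂ) := by
  funext v
  have h := congr_fun hu v
  rw [SimpleGraph.adjMatrix_mulVec_apply, Pi.smul_apply, smul_eq_mul] at h
  rw [SimpleGraph.adjMatrix_mulVec_apply, Pi.smul_apply, smul_eq_mul]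
  exact_mod_cast h

/-- **One-magnon eigenstates of the open XY chain** `H = ½ Σ_{i<n−1} (σ^x_i σ^x_{i+1} + σ^y_i σ^y_{i+1})`:
for each `k < n`, `|k̃⟩ = Σ_i sin((i+1)(k+1)π/(n+1)) |i⟩` satisfies `H |k̃⟩ = 2cos((k+1)π/(n+1)) |k̃⟩`
("The eigenstates are given by |k̃⟩ = √(2/(N+1)) Σ_n sin(πkn/(N+1)) |n⟩ with corresponding
eigenvalues [∓]2cos(kπ/(N+1))"). [cite: ChristandlEtAl2004, p. 2] [cite: BrouwerHaemers2012,
§1.4.4] -/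
theorem xyHam_pathGraph_mulVec_sineMode {n : ℕ} [DecidableRel (_root_.SimpleGraph.pathGraph n).Adj]
    (k : Fin n) :
    xyHam (_root_.SimpleGraph.pathGraph n) *ᵥ excLift (fun i => (pathMode n k i : ℂ)) =
      (pathEig n k : ℂ) • excLift (fun i => (pathMode n k i : ℂ)) :=
  xyHam_mulVec_excLift_of_eigen _
    (adjMatrix_complex_mulVec_of_real _ (adjMatrix_pathGraph_mulVec_pathMode k))

/-- … and on the open `m × n` grid (E-67's (S45) geometry): the product sine modes are one-magnon
eigenstates of `H_{P_m □ P_n}` with energies `2cos((a+1)π/(m+1)) + 2cos((b+1)π/(n+1))`.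
[cite: ChristandlEtAl2004, p. 2] [cite: BrouwerHaemers2012, §1.4.4 and §1.4.6] -/
theorem xyHam_grid_mulVec_sineMode {m n : ℕ}
    [DecidableRel (_root_.SimpleGraph.pathGraph m □ _root_.SimpleGraph.pathGraph n).Adj]
    (a : Fin m) (b : Fin n) :
    xyHam (_root_.SimpleGraph.pathGraph m □ _root_.SimpleGraph.pathGraph n) *ᵥ
        excLift (fun x => ((pathMode m a x.1 * pathMode n b x.2 : ℝ) : ℂ)) =
      ((pathEig m a + pathEig n b : ℝ) : ℂ) •
        excLift (fun x => ((pathMode m a x.1 * pathMode n b x.2 : ℝ) : ℂ)) :=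
  xyHam_mulVec_excLift_of_eigen _
    (adjMatrix_complex_mulVec_of_real _ (adjMatrix_grid_mulVec_pathMode a b))

/-- **The printed transfer amplitude of the uniformly coupled chain**: for the open XY chain on
`n` qubits and every `z ∈ ℂ`,
`⟨i| e^{zH} |j⟩ = (2/(n+1)) Σ_k sin((i+1)θ_k) e^{2z cos θ_k} sin((j+1)θ_k)`, `θ_k = (k+1)π/(n+1)` —
with `z = −it`, `i = 0`, `j = n − 1` this is "F(t) = (2/(N+1)) Σ_{k=1}^{N} sin(πk/(N+1)) sin(πkN/(N+1))
e^{−iE_k t}". [cite: ChristandlEtAl2004, p. 2] [cite: BrouwerHaemers2012, §1.4.4] -/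
theorem exp_smul_xyHam_pathGraph_exc_exc {n : ℕ} [DecidableRel (_root_.SimpleGraph.pathGraph n).Adj]
    (z : ℂ) (i j : Fin n) :
    NormedSpace.exp (z • xyHam (_root_.SimpleGraph.pathGraph n)) (exc i) (exc j) =
      ((2 / ((n + 1 : ℕ) : ℝ) : ℝ) : ℂ) *
        ∑ k, (pathMode n k i : ℂ) *
          Complex.exp (z * (pathEig n k : ℂ)) *
          (pathMode n k j : ℂ) := by
  rw [exp_smul_xyHam_exc_exc, exp_smul_adjMatrix_pathGraph_complex,
    Matrix.smul_apply, smul_eq_mul, mul_apply]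
  congr 1
  refine sum_congr rfl fun k _ => ?_
  rw [mul_diagonal, transpose_apply, sineMatrixC_apply,
    sineMatrixC_apply]

end Literature.Computability.QuantumComplexity


/-! ## The printed two- and three-spin transfer amplitudes (appended section)

"Perfect state transfer from one end of the chain to another is possible only for `N = 2` and
`N = 3`, with `F(t) = −i sin(t)` and `F(t) = −[sin(t/√2)]²` respectively."
[ChristandlEtAl2004, p. 2, the sentence after the display of `F(t)`]. Both values follow from
`exp_smul_xyHam_pathGraph_exc_exc` at `z = −it` by evaluating the two resp. three sine modes
(`sin(π/3) = √3/2`; `sin(π/4) = √2/2`, `sin(π/2) = 1`) and eigenvalues (`2cos(π/3) = 1`,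
`2cos(2π/3) = −1`; `2cos(π/4) = √2`, `2cos(π/2) = 0`, `2cos(3π/4) = −√2`): for `N = 2`,
`F(t) = (2/3)(3/4)(e^{−it} − e^{it}) = −i sin t`; for `N = 3`,
`F(t) = (1/2)((cos √2t) − 1) = −sin²(t/√2)`. (Perfect transfer: `|F| = 1` at `t = π/2` resp.
`t = π/√2`; the 'only for' half of the sentence is a statement about all `N ≥ 4` and is not
formalised here.) -/

namespace Literature.Computability.QuantumComplexity

open Finset Matrix Literature.Combinatorics.SimpleGraph Real

/-- **`N = 2`: `F(t) = ⟨2|e^{−itH}|1⟩ = −i sin t`** for the uniformly coupled two-spin XY chain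
(`H = xyHam (pathGraph 2)`, sites `0, 1`). [cite: ChristandlEtAl2004, p. 2 ('with
F(t) = −i sin(t) … respectively', N = 2)] -/
theorem exp_xyHam_pathGraph_two_transfer [DecidableRel (_root_.SimpleGraph.pathGraph 2).Adj]
    (t : ℝ) :
    NormedSpace.exp ((-Complex.I * t) • xyHam (_root_.SimpleGraph.pathGraph 2)) (exc 1) (exc 0)
      = -Complex.I * (Real.sin t : ℂ) := by
  rw [exp_smul_xyHam_pathGraph_exc_exc, Fin.sum_univ_two]
  -- angles
  have hθ0 : pathAngle 2 0 = π / 3 := by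
    simp only [pathAngle, Fin.val_zero]; push_cast; ring
  have hθ1 : pathAngle 2 1 = π - π / 3 := by
    simp only [pathAngle, Fin.val_one]; push_cast; ring
  have hs3 : Real.sin (π / 3) ^ 2 = 3 / 4 := by
    rw [Real.sin_pi_div_three, div_pow, Real.sq_sqrt (by norm_num : (0:ℝ) ≤ 3)]; norm_num
  -- modes and eigenvalues
  have m00 : pathMode 2 0 0 = Real.sin (π / 3) := by
    simp only [pathMode, Fin.val_zero, hθ0]; push_cast; ring_nf
  have m01 : pathMode 2 0 1 = Real.sin (π / 3) := by
    simp only [pathMode, Fin.val_one, hθ0]; push_cast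
    rw [show (2:ℝ) * (π / 3) = π - π / 3 by ring, Real.sin_pi_sub]
  have m10 : pathMode 2 1 0 = Real.sin (π / 3) := by
    simp only [pathMode, Fin.val_zero, hθ1]; push_cast
    rw [one_mul, Real.sin_pi_sub]
  have m11 : pathMode 2 1 1 = -Real.sin (π / 3) := by
    simp only [pathMode, Fin.val_one, hθ1]; push_cast
    rw [show (2:ℝ) * (π - π / 3) = π / 3 + π by ring, Real.sin_add_pi]
  have e0 : pathEig 2 0 = 1 := by
    simp only [pathEig, hθ0, Real.cos_pi_div_three]; norm_num
  have e1 : pathEig 2 1 = -1 := by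
    simp only [pathEig, hθ1, Real.cos_pi_sub, Real.cos_pi_div_three]; norm_num
  rw [m00, m01, m10, m11, e0, e1]
  -- complex exponentials
  have hp : Complex.exp (-Complex.I * t * ((1:ℝ) : ℂ)) = Real.cos t - Real.sin t * Complex.I := by
    rw [Complex.ofReal_one, mul_one, show -Complex.I * t = (((-t : ℝ) : ℂ)) * Complex.I by push_cast; ring,
      Complex.exp_mul_I, ← Complex.ofReal_cos, ← Complex.ofReal_sin, Real.cos_neg, Real.sin_neg]
    push_cast; ring
  have hm : Complex.exp (-Complex.I * t * ((-1:ℝ) : ℂ)) = Real.cos t + Real.sin t * Complex.I := by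
    rw [show -Complex.I * t * ((-1:ℝ) : ℂ) = (t : ℂ) * Complex.I by push_cast; ring,
      Complex.exp_mul_I, ← Complex.ofReal_cos, ← Complex.ofReal_sin]
  rw [hp, hm]
  -- the real constant, in the cast-normal form
  have hc : Complex.sin ((π : ℂ) / 3) ^ 2 = 3 / 4 := by
    have h := congrArg (fun x : ℝ => (x : ℂ)) hs3
    push_cast at h
    exact h
  push_cast
  linear_combination (Complex.sin ↑t * Complex.I * (-4 / 3)) * hc

/-- **`N = 3`: `F(t) = ⟨3|e^{−itH}|1⟩ = −sin²(t/√2)`** for the uniformly coupled three-spin XY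
chain (`H = xyHam (pathGraph 3)`, sites `0, 1, 2`). [cite: ChristandlEtAl2004, p. 2 ('and
F(t) = −[sin(t/√2)]² respectively', N = 3)] -/
theorem exp_xyHam_pathGraph_three_transfer [DecidableRel (_root_.SimpleGraph.pathGraph 3).Adj]
    (t : ℝ) :
    NormedSpace.exp ((-Complex.I * t) • xyHam (_root_.SimpleGraph.pathGraph 3)) (exc 2) (exc 0)
      = -(((Real.sin (t / Real.sqrt 2)) ^ 2 : ℝ) : ℂ) := by
  rw [exp_smul_xyHam_pathGraph_exc_exc, Fin.sum_univ_three]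
  -- angles
  have hθ0 : pathAngle 3 0 = π / 4 := by
    simp only [pathAngle, Fin.val_zero]; push_cast; ring
  have hθ1 : pathAngle 3 1 = π / 2 := by
    simp only [pathAngle, Fin.val_one]; push_cast; ring
  have hθ2 : pathAngle 3 2 = π - π / 4 := by
    simp only [pathAngle, Fin.val_two]; push_cast; ring
  have hs2 : Real.sin (π / 4) ^ 2 = 1 / 2 := by
    rw [Real.sin_pi_div_four, div_pow, Real.sq_sqrt (by norm_num : (0:ℝ) ≤ 2)]; norm_num
  -- modes (rows `exc 2`, `exc 0`) and eigenvalues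
  have m00 : pathMode 3 0 0 = Real.sin (π / 4) := by
    simp only [pathMode, Fin.val_zero, hθ0]; push_cast; ring_nf
  have m02 : pathMode 3 0 2 = Real.sin (π / 4) := by
    simp only [pathMode, Fin.val_two, hθ0]; push_cast
    rw [show (3 : ℝ) * (π / 4) = π - π / 4 by ring, Real.sin_pi_sub]
  have m10 : pathMode 3 1 0 = 1 := by
    simp only [pathMode, Fin.val_zero, hθ1]; push_cast
    rw [one_mul, Real.sin_pi_div_two]
  have m12 : pathMode 3 1 2 = -1 := by
    simp only [pathMode, Fin.val_two, hθ1]; push_cast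
    rw [show (3 : ℝ) * (π / 2) = π / 2 + π by ring, Real.sin_add_pi, Real.sin_pi_div_two]
  have m20 : pathMode 3 2 0 = Real.sin (π / 4) := by
    simp only [pathMode, Fin.val_zero, hθ2]; push_cast
    rw [one_mul, Real.sin_pi_sub]
  have m22 : pathMode 3 2 2 = Real.sin (π / 4) := by
    simp only [pathMode, Fin.val_two, hθ2]; push_cast
    rw [show (3 : ℝ) * (π - π / 4) = π / 4 + 2 * π by ring, Real.sin_add_two_pi]
  have e0 : pathEig 3 0 = Real.sqrt 2 := by
    simp only [pathEig, hθ0, Real.cos_pi_div_four]; ring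
  have e1 : pathEig 3 1 = 0 := by
    simp only [pathEig, hθ1, Real.cos_pi_div_two]; ring
  have e2 : pathEig 3 2 = -Real.sqrt 2 := by
    simp only [pathEig, hθ2, Real.cos_pi_sub, Real.cos_pi_div_four]; ring
  rw [m00, m02, m10, m12, m20, m22, e0, e1, e2]
  -- complex exponentials
  have hp : Complex.exp (-Complex.I * t * ((Real.sqrt 2 : ℝ) : ℂ))
      = Real.cos (Real.sqrt 2 * t) - Real.sin (Real.sqrt 2 * t) * Complex.I := by
    rw [show -Complex.I * t * ((Real.sqrt 2 : ℝ) : ℂ) = (((-(Real.sqrt 2 * t) : ℝ)) : ℂ) * Complex.I by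
        push_cast; ring,
      Complex.exp_mul_I, ← Complex.ofReal_cos, ← Complex.ofReal_sin, Real.cos_neg, Real.sin_neg]
    push_cast; ring
  have hm : Complex.exp (-Complex.I * t * ((-Real.sqrt 2 : ℝ) : ℂ))
      = Real.cos (Real.sqrt 2 * t) + Real.sin (Real.sqrt 2 * t) * Complex.I := by
    rw [show -Complex.I * t * ((-Real.sqrt 2 : ℝ) : ℂ) = (((Real.sqrt 2 * t : ℝ)) : ℂ) * Complex.I by
        push_cast; ring,
      Complex.exp_mul_I, ← Complex.ofReal_cos, ← Complex.ofReal_sin]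
  have hz : Complex.exp (-Complex.I * t * ((0 : ℝ) : ℂ)) = 1 := by simp
  rw [hp, hm, hz]
  -- the double-angle identity `cos(√2 t) = 1 − 2 sin²(t/√2)` and the constant `sin²(π/4) = 1/2`
  have hsq : Real.sqrt 2 * Real.sqrt 2 = 2 := Real.mul_self_sqrt (by norm_num)
  have hda : Real.cos (Real.sqrt 2 * t) = 1 - 2 * Real.sin (t / Real.sqrt 2) ^ 2 := by
    have h2 : Real.sqrt 2 * t = 2 * (t / Real.sqrt 2) := by
      have hne : Real.sqrt 2 ≠ 0 := by positivity
      field_simp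
      rw [sq, hsq]; ring
    rw [h2, Real.cos_two_mul, Real.cos_sq']
    ring
  have hc : Complex.sin ((π : ℂ) / 4) ^ 2 = 1 / 2 := by
    have h := congrArg (fun x : ℝ => (x : ℂ)) hs2
    push_cast at h
    exact h
  have hdaC : Complex.cos ((Real.sqrt 2 : ℂ) * t) = 1 - 2 * Complex.sin ((t : ℂ) / (Real.sqrt 2 : ℂ)) ^ 2 := by
    have h := congrArg (fun x : ℝ => (x : ℂ)) hda
    push_cast at h
    exact h
  push_cast
  linear_combination (Complex.cos (↑(Real.sqrt 2) * ↑t)) * hc + (1 / 2 : ℂ) * hdaC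

end Literature.Computability.QuantumComplexity

end
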